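import Summits.QuantumFields.YangMills.Theorems.SwapVirialDeficitSectorLaplaceBTubeMainTerm
import Summits.QuantumFields.YangMills.Theorems.SwapVirialDeficitSectorLaplaceBulkStiffness
import HarnessLib

/-!
# STUB (S-B) OF SKELETON ➎: THE B-TUBE STIFFNESS FROM THE √b LAW — `κ_L·∫_{Rg} e^{−bF_B} dμ_B ≤ b·∫_{Rg} F_B e^{−bF_B} dμ_B`, modulo the far floor
# (free-hands support of ⟨stmt-QuantumFields-24197⟩ `SwapVirialDeficit.SwapGluedStiffness` ∕ ⟨24194⟩; cell ym-idea-1, LEAD memo7 §E(3); g47's bulk pattern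
# ✓`bulk_stiff_sur_sign`: relative law ⟹ two-sided log law (w2 ✓`twoSided_logLaw_of_relative`) ⟹ stiffness (LEAD g98 ✓`setStiffness_of_twoSided_logLaplace`, g47 ✓`stiff_budget`))

In the letters `(δ, η) ∈ X = ℝ × GnoCoord L` against `μ_B = vol·((1+δ²)⁻¹)²ρ` (✓`setIntegral_BTube_exp∕action_eq_hubCot` translate g47's `stub_B_stiff` into exactly these integrals,
up to the common factor `coneConst·π`), over any measurable region `Rg` between the scaled tube and the cylinder over `S_τ = {τ² ≤ |u|²}`:
* §1 `finrank_gnoFibreB_real_div_two` (`m_B∕2 = 9L⁴ − ½ ≥ α`, `alpha_le_finrank_gnoFibreB_div_two`), `muB_real_univ_le` (`μ_B(X) ≤ π·e^{|log(coneConst³∕64)| + 18L⁴}`),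
  `bBaseWeight_ge_on_square` (`w₀ ≥ 16∕81` on `[½,1]×[0,½]`; inside §2 this gives the main-term FLOOR `M = ∫_{S_τ} w₀∕√det A′ ≥ M₀ = (4∕81)∕√((39984L⁴)^{m_B})` for `τ ≤ ½`
  from the determinant ceiling of ✓`bTube_mainTerm_package`), `bRate_antitone` (the relative error `K₃∕√t + K₄∕t + t^{−1∕4}` decreases);
* §2 ★★★ `bTube_stiff_of_farFloor` — principal signs, `0 < τ ≤ ½`, radius `R` (`1136016L⁴R ≤ λ_B∕(8(m_B+8))`, `2R² ≤ 1`), region `Rg` (measurable; scaled tube of radius `R`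
  over `S_τ` inside; inside the cylinder over `S_τ`), the FAR FLOOR on `Rg` off the tube, and `b ≥ 1` with the two explicit smallness conditions
  `K₃∕√b + K₄∕b + b^{−1∕4} ≤ 1∕(20000L⁴)` and `e^{−tλ_B R²}·U₀ ≤ t^{−1∕4}(2π∕t)^{m_B∕2}M₀` for `t ∈ [b, 2b]` (both polynomial thresholds in `τ⁻¹, L`, cf. ✓`exp_absorb`):
  `stiffKappa L (1∕8) · ∫_{Rg} e^{−bF_B} dμ_B ≤ b · ∫_{Rg} F_B e^{−bF_B} dμ_B`.

HONEST LABEL: (S-B) is NOT closed: the far floor on the capped tube (LEAD 20:48Z `BTubeCap`, owner w3-successor ∕ LEAD), the `BTubeCap` reading and the conversion of the two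
smallness conditions into g47's `K·L^k·τ⁻¹^k ≤ b` remain; (S-core), (S-001), ⟨24197⟩ ∕ ⟨24194⟩ OPEN; own crux ⟨22884⟩ OPEN (blocked-on ⟨19935⟩); the Yang–Mills mass gap is NOT
proved; no summit is proved by a line.  THEOREMS ONLY (0 `def`, 0 `sorry`), standard axioms.  Width seat ym-line-sfw-p2-w2 g59 (cell ym-idea-1, free hands),
`--supports stmt-QuantumFields-24197`.  References: [cite: Luscher1983, §2]; [cite: Griffiths1964]; [folklore].
-/

set_option autoImplicit false
set_option synthInstance.maxSize 1024

noncomputable section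

open MeasureTheory Quaternion Set Metric Module
open scoped Quaternion BigOperators ENNReal InnerProductSpace
open Literature.MathematicalPhysics.QuantumLattice
open Literature.MathematicalPhysics.QuantumFieldTheory hiding SU2
open Summit.QuantumFields.YangMills.Theorems.SwapTwistDeficit.ToronLog

namespace Summit.QuantumFields.YangMills.Theorems.SwapVirialDeficit.BlowUpRing

open Summit.QuantumFields.YangMills.Theorems.FemtoTransferGap
open Summit.QuantumFields.YangMills.Theorems.FemtoTransferGap.TT
open Summit.QuantumFields.YangMills.Theorems.VirialFluxGap.RingDeficit
open Summit.QuantumFields.YangMills.Theorems.SwapVirialDeficit.SwapRing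
open Summit.QuantumFields.YangMills.Theorems.SwapVirialDeficit.SectorLaplace
open Summit.QuantumFields.YangMills.Theorems.SwapVirialDeficit.Gnomonic (normSq3 normSq3_nonneg gnomonicWeight gnomonicWeight_pos)

variable {L : ℕ} [NeZero L]

/-! ## §1 Dimension, total mass, main-term floor, monotone rate -/

/-- `m_B∕2 = 9L⁴ − ½` (`m_B = 8 + 3|Fol L| = 18L⁴ − 1`). [folklore] -/
theorem finrank_gnoFibreB_real_div_two : (finrank ℝ (GnoFibreB L) : ℝ) / 2 = 9 * (L : ℝ) ^ 4 - 1 / 2 := by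
  rw [finrank_gnoFibreB_real, card_fol]
  have h1 : 1 ≤ L ^ 4 := Nat.one_le_pow _ _ (Nat.pos_of_ne_zero (NeZero.ne L))
  have h2 : 3 ≤ 6 * L ^ 4 := by omega
  rw [Nat.cast_sub h2]; push_cast; ring

/-- `α = 9L⁴ − 1 ≤ m_B∕2`. [folklore] -/
theorem alpha_le_finrank_gnoFibreB_div_two : alpha L ≤ (finrank ℝ (GnoFibreB L) : ℝ) / 2 := by
  unfold alpha
  rw [finrank_gnoFibre_real_div_two, finrank_gnoFibreB_real_div_two]
  linarith

/-- ★ **THE TOTAL MASS OF `μ_B`**: `μ_B(X) ≤ π·e^{|log(coneConst³∕64)| + 18L⁴}` (`∫((1+δ²)⁻¹)² ≤ ∫(1+δ²)⁻¹ = π`, ✓`totalMass_le_exp`). [folklore] -/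
theorem muB_real_univ_le :
    ((volume : Measure (ℝ × GnoCoord L)).withDensity fun p => ENNReal.ofReal (((1 + p.1 ^ 2)⁻¹) ^ 2 * gnoDensity p.2)).real univ ≤
      Real.pi * Real.exp (|Real.log (coneConst ^ 3 / 64)| + 18 * (L : ℝ) ^ 4) := by
  have hwm : Measurable fun δ : ℝ => ((1 + δ ^ 2)⁻¹) ^ 2 := ((measurable_const.add (measurable_id.pow_const 2)).inv).pow_const 2
  have hwle : ∀ δ : ℝ, ((1 + δ ^ 2)⁻¹) ^ 2 ≤ (1 + δ ^ 2)⁻¹ := fun δ => by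
    have h0 : 0 ≤ (1 + δ ^ 2)⁻¹ := by positivity
    have h1 : (1 + δ ^ 2)⁻¹ ≤ 1 := by rw [inv_le_one_iff₀]; right; nlinarith [sq_nonneg δ]
    nlinarith
  have hwi : Integrable fun δ : ℝ => ((1 + δ ^ 2)⁻¹) ^ 2 := by
    refine (integrable_inv_one_add_sq).mono' hwm.aestronglyMeasurable (Filter.Eventually.of_forall fun δ => ?_)
    rw [Real.norm_eq_abs, abs_of_nonneg (by positivity)]
    exact hwle δ
  have hprod : Integrable (fun p : ℝ × GnoCoord L => ((1 + p.1 ^ 2)⁻¹) ^ 2 * gnoDensity p.2) (volume : Measure (ℝ × GnoCoord L)) := by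
    rw [Measure.volume_eq_prod]; exact hwi.mul_prod (integrable_gnoDensity (L := L))
  have hnn : 0 ≤ᵐ[(volume : Measure (ℝ × GnoCoord L))] fun p : ℝ × GnoCoord L => ((1 + p.1 ^ 2)⁻¹) ^ 2 * gnoDensity p.2 :=
    Filter.Eventually.of_forall fun p => (bDensity_pos p).le
  rw [measureReal_def, withDensity_apply _ MeasurableSet.univ, Measure.restrict_univ, ← ofReal_integral_eq_lintegral_ofReal hprod hnn,
    ENNReal.toReal_ofReal (integral_nonneg fun p => (bDensity_pos p).le), Measure.volume_eq_prod,
    integral_prod_mul (fun δ : ℝ => ((1 + δ ^ 2)⁻¹) ^ 2) (fun η : GnoCoord L => gnoDensity η)]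
  have h1 : ∫ δ : ℝ, ((1 + δ ^ 2)⁻¹) ^ 2 ≤ Real.pi := by
    rw [← integral_univ_inv_one_add_sq]
    exact integral_mono hwi integrable_inv_one_add_sq hwle
  have h2 := totalMass_le_exp (L := L)
  have h3 : 0 ≤ ∫ δ : ℝ, ((1 + δ ^ 2)⁻¹) ^ 2 := integral_nonneg fun δ => by positivity
  have h4 : 0 ≤ ∫ η : GnoCoord L, gnoDensity η := integral_nonneg fun η => (gnoDensity_pos η).le
  exact mul_le_mul h1 h2 h4 Real.pi_pos.le

/-- The B-base weight is `≥ 16∕81` on the square `[½,1] × [0,½]`. [folklore] -/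
theorem bBaseWeight_ge_on_square {u : ℝ × ℝ} (hu : u ∈ Icc (1 / 2 : ℝ) 1 ×ˢ Icc (0 : ℝ) (1 / 2)) :
    16 / 81 ≤ gnomonicWeight (![0, u.1, u.2] : Fin 3 → ℝ) * Real.sqrt (1 + (u.1 ^ 2 + u.2 ^ 2)) := by
  obtain ⟨⟨h1, h2⟩, ⟨h3, h4⟩⟩ := mem_prod.1 hu
  have ew : gnomonicWeight (![0, u.1, u.2] : Fin 3 → ℝ) = ((1 + (u.1 ^ 2 + u.2 ^ 2))⁻¹) ^ 2 := by
    simp [gnomonicWeight, normSq3, Fin.sum_univ_three]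
  rw [ew]
  have hU : u.1 ^ 2 + u.2 ^ 2 ≤ 5 / 4 := by nlinarith
  have hpos : 0 < 1 + (u.1 ^ 2 + u.2 ^ 2) := by positivity
  have hinv : 4 / 9 ≤ (1 + (u.1 ^ 2 + u.2 ^ 2))⁻¹ := by
    rw [le_inv_comm₀ (by norm_num) hpos]; norm_num; linarith
  have hsq : 16 / 81 ≤ ((1 + (u.1 ^ 2 + u.2 ^ 2))⁻¹) ^ 2 := by nlinarith
  have hsqrt : 1 ≤ Real.sqrt (1 + (u.1 ^ 2 + u.2 ^ 2)) := Real.one_le_sqrt.2 (by nlinarith [sq_nonneg u.1, sq_nonneg u.2])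
  nlinarith [hsq, hsqrt, sq_nonneg ((1 + (u.1 ^ 2 + u.2 ^ 2))⁻¹)]

omit [NeZero L] in
/-- The relative rate `K₃∕√t + K₄∕t + t^{−1∕4}` is antitone in `t ≥ 1` (`K₃, K₄ ≥ 0`). [folklore] -/
theorem bRate_antitone {K₃ K₄ t t' : ℝ} (hK₃ : 0 ≤ K₃) (hK₄ : 0 ≤ K₄) (ht : 1 ≤ t) (htt : t ≤ t') :
    K₃ / Real.sqrt t' + K₄ / t' + t' ^ (-(1 / 4 : ℝ)) ≤ K₃ / Real.sqrt t + K₄ / t + t ^ (-(1 / 4 : ℝ)) := by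
  have ht0 : 0 < t := by linarith
  have ht0' : 0 < t' := by linarith
  have h1 : K₃ / Real.sqrt t' ≤ K₃ / Real.sqrt t := div_le_div_of_nonneg_left hK₃ (Real.sqrt_pos.2 ht0) (Real.sqrt_le_sqrt htt)
  have h2 : K₄ / t' ≤ K₄ / t := div_le_div_of_nonneg_left hK₄ ht0 htt
  have h3 : t' ^ (-(1 / 4 : ℝ)) ≤ t ^ (-(1 / 4 : ℝ)) := Real.rpow_le_rpow_of_nonpos ht0 htt (by norm_num)
  linarith

/-! ## §2 The B-tube stiffness modulo the far floor -/

set_option maxHeartbeats 800000 in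
/-- ★★★ **THE B-TUBE STIFFNESS FROM THE √b LAW, MODULO THE FAR FLOOR** (principal signs `ε_z = +`, followers `+`; `0 < τ ≤ ½`; `λ_B = τ²∕((1+τ²)·12375·L¹⁰)`,
`m_B = dim V_B`, `M₀ = (4∕81)∕√((39984L⁴)^{m_B})`, `U₀ = π·e^{|log(coneConst³∕64)| + 18L⁴}`).  For a radius `R` with `1136016L⁴R ≤ λ_B∕(8(m_B+8))`, `2R² ≤ 1`, a measurable
region `Rg ⊆ ℝ × GnoCoord L` containing the scaled tube of radius `R` over `S_τ = {τ² ≤ |u|²}` and contained in the cylinder over `S_τ`, the FAR FLOOR `λ_B R² ≤ F_B` on `Rg` off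
the tube, and `b ≥ 1` with `K₃∕√b + K₄∕b + b^{−1∕4} ≤ 1∕(20000L⁴)` and `e^{−tλ_B R²}U₀ ≤ t^{−1∕4}(2π∕t)^{m_B∕2}M₀` for `t ∈ [b, 2b]`:
`stiffKappa L (1∕8) · ∫_{Rg} e^{−bF_B} dμ_B ≤ b · ∫_{Rg} F_B e^{−bF_B} dμ_B`. [cite: Luscher1983, §2] [cite: Griffiths1964] -/
theorem bTube_stiff_of_farFloor (ε : GnoSign L) (hz : ε.2.1 = true) (hε : ε.2.2 = fun _ => true) {τ : ℝ} (hτ : 0 < τ) (hτ2 : τ ≤ 1 / 2)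
    {Rg : Set (ℝ × GnoCoord L)} (hRgm : MeasurableSet Rg) {R b : ℝ} (hR : 0 < R)
    (htube : ∀ u : ℝ × ℝ, τ ^ 2 ≤ u.1 ^ 2 + u.2 ^ 2 → ∀ y : GnoFibreB L, ‖y‖ ≤ R → gnoFibreBEquiv (u, gnoScaleB u y) ∈ Rg)
    (hcyl : Rg ⊆ {p : ℝ × GnoCoord L | τ ^ 2 ≤ p.2.1.1 1 ^ 2 + p.2.1.1 2 ^ 2})
    (hsmall : 1136016 * (L : ℝ) ^ 4 * R ≤ τ ^ 2 / ((1 + τ ^ 2) * (12375 * (L : ℝ) ^ 10)) / (8 * ((finrank ℝ (GnoFibreB L) : ℝ) + 8))) (hDR : 2 * R * R ≤ 1)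
    (hfar : ∀ u : ℝ × ℝ, τ ^ 2 ≤ u.1 ^ 2 + u.2 ^ 2 → ∀ y : GnoFibreB L, R ≤ ‖y‖ → gnoFibreBEquiv (u, gnoScaleB u y) ∈ Rg →
      τ ^ 2 / ((1 + τ ^ 2) * (12375 * (L : ℝ) ^ 10)) * R ^ 2 ≤
        gnoDeficit (fun _ => false) (fun _ => 1) (hubAt (gnoFibreBEquiv (u, gnoScaleB u y)).1 1) ε (gnoFibreBEquiv (u, gnoScaleB u y)).2)
    (hb1 : 1 ≤ b)
    (hrate : (16 * (1136016 * (L : ℝ) ^ 4) * ((finrank ℝ (GnoFibreB L) : ℝ) + 8) / (τ ^ 2 / ((1 + τ ^ 2) * (12375 * (L : ℝ) ^ 10))) +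
          256 * (1136016 * (L : ℝ) ^ 4) * ((finrank ℝ (GnoFibreB L) : ℝ) + 8) ^ 2 / (τ ^ 2 / ((1 + τ ^ 2) * (12375 * (L : ℝ) ^ 10))) ^ 2 + 2 * R +
          8 * (2 * R) * ((finrank ℝ (GnoFibreB L) : ℝ) + 8) / (τ ^ 2 / ((1 + τ ^ 2) * (12375 * (L : ℝ) ^ 10)))) / Real.sqrt b +
        16 * ((finrank ℝ (GnoFibreB L) : ℝ) + 8) / (τ ^ 2 / ((1 + τ ^ 2) * (12375 * (L : ℝ) ^ 10)) * R ^ 2) / b + b ^ (-(1 / 4 : ℝ)) ≤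
      1 / (20000 * (L : ℝ) ^ 4))
    (habs : ∀ t : ℝ, b ≤ t → t ≤ 2 * b →
      Real.exp (-(t * (τ ^ 2 / ((1 + τ ^ 2) * (12375 * (L : ℝ) ^ 10)) * R ^ 2))) * (Real.pi * Real.exp (|Real.log (coneConst ^ 3 / 64)| + 18 * (L : ℝ) ^ 4)) ≤
        t ^ (-(1 / 4 : ℝ)) * ((2 * Real.pi / t) ^ ((finrank ℝ (GnoFibreB L) : ℝ) / 2) * ((4 / 81) / Real.sqrt ((39984 * (L : ℝ) ^ 4) ^ finrank ℝ (GnoFibreB L))))) :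
    stiffKappa L (1 / 8) *
        ∫ p in Rg, Real.exp (-(b * gnoDeficit (fun _ => false) (fun _ => 1) (hubAt p.1 1) ε p.2))
          ∂((volume : Measure (ℝ × GnoCoord L)).withDensity fun p => ENNReal.ofReal (((1 + p.1 ^ 2)⁻¹) ^ 2 * gnoDensity p.2)) ≤
      b * ∫ p in Rg, gnoDeficit (fun _ => false) (fun _ => 1) (hubAt p.1 1) ε p.2 *
          Real.exp (-(b * gnoDeficit (fun _ => false) (fun _ => 1) (hubAt p.1 1) ε p.2))
          ∂((volume : Measure (ℝ × GnoCoord L)).withDensity fun p => ENNReal.ofReal (((1 + p.1 ^ 2)⁻¹) ^ 2 * gnoDensity p.2)) := by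
  have hL1 : (1 : ℝ) ≤ L := by exact_mod_cast NeZero.one_le
  have hL0 : (0 : ℝ) < L := by linarith
  have hτ1 : τ ≤ 1 := by linarith
  have hb0 : 0 < b := by linarith
  -- the package
  obtain ⟨A, hAs, -, -, hcoer, -, hdet, hint, hlaw⟩ := bTube_mainTerm_package (L := L) ε hz hε hτ hτ1
  -- names
  set μB : Measure (ℝ × GnoCoord L) := (volume : Measure (ℝ × GnoCoord L)).withDensity fun p => ENNReal.ofReal (((1 + p.1 ^ 2)⁻¹) ^ 2 * gnoDensity p.2) with hμB
  haveI : IsFiniteMeasure μB := isFiniteMeasure_muB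
  set F : ℝ × GnoCoord L → ℝ := fun p => gnoDeficit (fun _ => false) (fun _ => 1) (hubAt p.1 1) ε p.2 with hFdef
  have hFm : Measurable F := measurable_bDeficit _ _ ε
  obtain ⟨B, -, hB⟩ := exists_abs_gnoDeficit_le (L := L)
  have hFbd : ∀ p, |F p| ≤ B := fun p => hB (hubAt p.1 1) ε p.2
  set lam : ℝ := τ ^ 2 / ((1 + τ ^ 2) * (12375 * (L : ℝ) ^ 10)) with hlam
  have hlam0 : 0 < lam := by positivity
  set m : ℝ := (finrank ℝ (GnoFibreB L) : ℝ) with hm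
  have hm0 : 0 ≤ m := Nat.cast_nonneg _
  set e : ℝ := m / 2 with hedef
  have he0 : 0 ≤ e := by positivity
  set Sτ : Set (ℝ × ℝ) := {u : ℝ × ℝ | τ ^ 2 ≤ u.1 ^ 2 + u.2 ^ 2} with hSτ
  have hSτm : MeasurableSet Sτ := measurableSet_le measurable_const ((measurable_fst.pow_const 2).add (measurable_snd.pow_const 2))
  have hp₀ : ((1, 0) : ℝ × ℝ) ∈ Sτ := by show τ ^ 2 ≤ (1 : ℝ) ^ 2 + (0 : ℝ) ^ 2; nlinarith
  set w₀ : ℝ × ℝ → ℝ := fun u => gnomonicWeight (![0, u.1, u.2] : Fin 3 → ℝ) * Real.sqrt (1 + (u.1 ^ 2 + u.2 ^ 2)) with hw₀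
  set M : ℝ := ∫ u in Sτ, w₀ u / Real.sqrt (LinearMap.det (A u)) with hMdef
  set M₀ : ℝ := (4 / 81) / Real.sqrt ((39984 * (L : ℝ) ^ 4) ^ finrank ℝ (GnoFibreB L)) with hM₀
  set U₀ : ℝ := Real.pi * Real.exp (|Real.log (coneConst ^ 3 / 64)| + 18 * (L : ℝ) ^ 4) with hU₀
  set K₃ : ℝ := 16 * (1136016 * (L : ℝ) ^ 4) * (m + 8) / lam + 256 * (1136016 * (L : ℝ) ^ 4) * (m + 8) ^ 2 / lam ^ 2 + 2 * R +
    8 * (2 * R) * (m + 8) / lam with hK₃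
  set K₄ : ℝ := 16 * (m + 8) / (lam * R ^ 2) with hK₄
  have hK₃0 : 0 ≤ K₃ := by positivity
  have hK₄0 : 0 ≤ K₄ := by positivity
  -- (i) the main-term floor `M₀ ≤ M`
  have hC0 : 0 < Real.sqrt ((39984 * (L : ℝ) ^ 4) ^ finrank ℝ (GnoFibreB L)) := Real.sqrt_pos.2 (by positivity)
  have hM₀pos : 0 < M₀ := by positivity
  have hQsub : Icc (1 / 2 : ℝ) 1 ×ˢ Icc (0 : ℝ) (1 / 2) ⊆ Sτ := by
    intro u hu
    obtain ⟨⟨h1, -⟩, ⟨h3, -⟩⟩ := mem_prod.1 hu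
    show τ ^ 2 ≤ u.1 ^ 2 + u.2 ^ 2
    nlinarith
  have hinteg_nn : ∀ u ∈ Sτ, 0 ≤ w₀ u / Real.sqrt (LinearMap.det (A u)) := fun u _ =>
    div_nonneg (mul_nonneg (gnomonicWeight_pos _).le (Real.sqrt_nonneg _)) (Real.sqrt_nonneg _)
  have hfloorQ : ∀ u ∈ Icc (1 / 2 : ℝ) 1 ×ˢ Icc (0 : ℝ) (1 / 2), 16 / 81 / Real.sqrt ((39984 * (L : ℝ) ^ 4) ^ finrank ℝ (GnoFibreB L)) ≤
      w₀ u / Real.sqrt (LinearMap.det (A u)) := by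
    intro u hu
    have hw := bBaseWeight_ge_on_square hu
    obtain ⟨hd1, hd2⟩ := hdet u (hQsub hu)
    have hdpos : 0 < LinearMap.det (A u) := lt_of_lt_of_le (by positivity) hd1
    have hs : Real.sqrt (LinearMap.det (A u)) ≤ Real.sqrt ((39984 * (L : ℝ) ^ 4) ^ finrank ℝ (GnoFibreB L)) := Real.sqrt_le_sqrt hd2
    have hs0 : 0 < Real.sqrt (LinearMap.det (A u)) := Real.sqrt_pos.2 hdpos
    calc 16 / 81 / Real.sqrt ((39984 * (L : ℝ) ^ 4) ^ finrank ℝ (GnoFibreB L)) ≤ 16 / 81 / Real.sqrt (LinearMap.det (A u)) :=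
          div_le_div_of_nonneg_left (by norm_num) hs0 hs
      _ ≤ w₀ u / Real.sqrt (LinearMap.det (A u)) := div_le_div_of_nonneg_right hw hs0.le
  have hvolQ : (volume : Measure (ℝ × ℝ)).real (Icc (1 / 2 : ℝ) 1 ×ˢ Icc (0 : ℝ) (1 / 2)) = 1 / 4 := by
    rw [measureReal_def, Measure.volume_eq_prod, Measure.prod_prod, Real.volume_Icc, Real.volume_Icc, ← ENNReal.ofReal_mul (by norm_num),
      ENNReal.toReal_ofReal (by norm_num)]
    norm_num
  have hMfloor : M₀ ≤ M := by
    have hQm : MeasurableSet (Icc (1 / 2 : ℝ) 1 ×ˢ Icc (0 : ℝ) (1 / 2)) := measurableSet_Icc.prod measurableSet_Icc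
    have hQfin : (volume : Measure (ℝ × ℝ)) (Icc (1 / 2 : ℝ) 1 ×ˢ Icc (0 : ℝ) (1 / 2)) ≠ ⊤ := by
      rw [Measure.volume_eq_prod, Measure.prod_prod, Real.volume_Icc, Real.volume_Icc]
      exact ENNReal.mul_ne_top ENNReal.ofReal_ne_top ENNReal.ofReal_ne_top
    have h1 := setIntegral_ge_of_const_le_real (μ := (volume : Measure (ℝ × ℝ))) hQm hQfin hfloorQ (hint.mono_set hQsub)
    have h2 : ∫ u in Icc (1 / 2 : ℝ) 1 ×ˢ Icc (0 : ℝ) (1 / 2), w₀ u / Real.sqrt (LinearMap.det (A u)) ≤ M :=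
      setIntegral_mono_set hint (ae_restrict_of_forall_mem hSτm hinteg_nn) (Filter.Eventually.of_forall hQsub)
    rw [hvolQ] at h1
    have e1 : M₀ = 16 / 81 / Real.sqrt ((39984 * (L : ℝ) ^ 4) ^ finrank ℝ (GnoFibreB L)) * (1 / 4) := by rw [hM₀]; ring
    rw [e1]
    exact h1.trans h2
  have hMpos : 0 < M := lt_of_lt_of_le hM₀pos hMfloor
  -- (ii) total mass
  have hμtot : μB.real univ ≤ U₀ := muB_real_univ_le (L := L)
  have hμtot0 : 0 ≤ μB.real univ := measureReal_nonneg
  -- (iii) the law at a time `t ∈ [b, 2b]`, in relative form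
  have hrel : ∀ t : ℝ, b ≤ t → t ≤ 2 * b →
      0 < ∫ p in Rg, Real.exp (-(t * F p)) ∂μB ∧
      -e * Real.log t + (e * Real.log (2 * Real.pi) + Real.log M) - 2 * (K₃ / Real.sqrt t + K₄ / t + t ^ (-(1 / 4 : ℝ))) ≤
          Real.log (∫ p in Rg, Real.exp (-(t * F p)) ∂μB) ∧
        Real.log (∫ p in Rg, Real.exp (-(t * F p)) ∂μB) ≤
          -e * Real.log t + (e * Real.log (2 * Real.pi) + Real.log M) + (K₃ / Real.sqrt t + K₄ / t + t ^ (-(1 / 4 : ℝ))) := by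
    intro t hbt ht2
    have ht0 : 0 < t := by linarith
    have ht1 : 1 ≤ t := hb1.trans hbt
    have hZ := hlaw hSτm (fun u hu => hu) hp₀ hRgm hR ht0 (fun u hu y hy => htube u hu y hy)
      (fun p hp => hcyl hp) hsmall hDR (fun u hu y hy hmem => hfar u hu y hy hmem)
    -- the rate
    have hr0 : 0 ≤ K₃ / Real.sqrt t + K₄ / t := by positivity
    have hx0 : 0 ≤ t ^ (-(1 / 4 : ℝ)) := Real.rpow_nonneg ht0.le _
    have hrate_t : K₃ / Real.sqrt t + K₄ / t + t ^ (-(1 / 4 : ℝ)) ≤ 1 / (20000 * (L : ℝ) ^ 4) := (bRate_antitone hK₃0 hK₄0 hb1 hbt).trans hrate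
    have hhalf : K₃ / Real.sqrt t + K₄ / t + t ^ (-(1 / 4 : ℝ)) ≤ 1 / 2 := hrate_t.trans (by
      rw [div_le_div_iff₀ (by positivity) (by norm_num)]; nlinarith [one_le_pow₀ (n := 4) hL1])
    -- absorb the tail
    have hP0 : 0 < (2 * Real.pi / t) ^ e := Real.rpow_pos_of_pos (by positivity) _
    have hX : Real.exp (-(t * (lam * R ^ 2))) * μB.real univ ≤ t ^ (-(1 / 4 : ℝ)) * ((2 * Real.pi / t) ^ e * M) := by
      have h1 := habs t hbt ht2
      calc Real.exp (-(t * (lam * R ^ 2))) * μB.real univ ≤ Real.exp (-(t * (lam * R ^ 2))) * U₀ :=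
            mul_le_mul_of_nonneg_left hμtot (Real.exp_pos _).le
        _ ≤ t ^ (-(1 / 4 : ℝ)) * ((2 * Real.pi / t) ^ e * M₀) := h1
        _ ≤ t ^ (-(1 / 4 : ℝ)) * ((2 * Real.pi / t) ^ e * M) := mul_le_mul_of_nonneg_left (mul_le_mul_of_nonneg_left hMfloor hP0.le) hx0
    -- the law in the form of `twoSided_logLaw_of_relative`
    have hZ' : |(∫ p in Rg, Real.exp (-(t * F p)) ∂μB) - (2 * Real.pi / t) ^ e * M| ≤
        (K₃ / Real.sqrt t + K₄ / t) * ((2 * Real.pi / t) ^ e * M) + Real.exp (-(t * (lam * R ^ 2))) * μB.real univ := by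
      have e1 : (K₃ / Real.sqrt t + K₄ / t) * ((2 * Real.pi / t) ^ e * M) =
          (K₃ / Real.sqrt t + 16 * (m + 8) / (lam * R ^ 2) / t) * ((2 * Real.pi / t) ^ e * M) := by rw [hK₄]
      rw [e1]
      exact hZ
    exact twoSided_logLaw_of_relative ht0 hMpos hZ' hX hr0 hx0 hhalf
  -- (iv) the two-sided log law at `b` and `(1+h)b`, then stiffness
  have hh0 : (0 : ℝ) < 1 / (40 * (L : ℝ) ^ 4) := by positivity
  have hhb : b ≤ (1 + 1 / (40 * (L : ℝ) ^ 4)) * b := by nlinarith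
  have hhb2 : (1 + 1 / (40 * (L : ℝ) ^ 4)) * b ≤ 2 * b := by
    have : 1 / (40 * (L : ℝ) ^ 4) ≤ 1 := by rw [div_le_one (by positivity)]; nlinarith [one_le_pow₀ (n := 4) hL1]
    nlinarith
  obtain ⟨hZpos, hlow, -⟩ := hrel b le_rfl (by linarith)
  obtain ⟨-, -, hup⟩ := hrel ((1 + 1 / (40 * (L : ℝ) ^ 4)) * b) hhb hhb2
  have hRpos : μB Rg ≠ 0 := by
    intro h0
    have : ∫ p in Rg, Real.exp (-(b * F p)) ∂μB = 0 := by rw [Measure.restrict_eq_zero.2 h0, integral_zero_measure]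
    rw [this] at hZpos; exact lt_irrefl _ hZpos
  have hRfin : μB Rg ≠ ⊤ := measure_ne_top _ _
  -- integrand forms `-(t*F)` ↔ `-t * F`
  have eZ : ∀ t : ℝ, ∫ p in Rg, Real.exp (-t * F p) ∂μB = ∫ p in Rg, Real.exp (-(t * F p)) ∂μB := fun t => by simp only [neg_mul]
  have eE : ∫ p in Rg, F p * Real.exp (-b * F p) ∂μB = ∫ p in Rg, F p * Real.exp (-(b * F p)) ∂μB := by simp only [neg_mul]
  have hst := setStiffness_of_twoSided_logLaplace μB hRpos hRfin hFm hFbd hb0 hh0 he0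
    (C := e * Real.log (2 * Real.pi) + Real.log M)
    (E₁ := 2 * (K₃ / Real.sqrt b + K₄ / b + b ^ (-(1 / 4 : ℝ))))
    (E₂ := K₃ / Real.sqrt ((1 + 1 / (40 * (L : ℝ) ^ 4)) * b) + K₄ / ((1 + 1 / (40 * (L : ℝ) ^ 4)) * b) +
      ((1 + 1 / (40 * (L : ℝ) ^ 4)) * b) ^ (-(1 / 4 : ℝ)))
    (by rw [eZ]; exact hlow) (by rw [eZ]; exact hup)
  rw [eZ, eE] at hst
  -- (v) the budget
  have hρb : K₃ / Real.sqrt b + K₄ / b + b ^ (-(1 / 4 : ℝ)) ≤ 1 / (20000 * (L : ℝ) ^ 4) := hrate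
  have hρb' : K₃ / Real.sqrt ((1 + 1 / (40 * (L : ℝ) ^ 4)) * b) + K₄ / ((1 + 1 / (40 * (L : ℝ) ^ 4)) * b) +
      ((1 + 1 / (40 * (L : ℝ) ^ 4)) * b) ^ (-(1 / 4 : ℝ)) ≤ 1 / (20000 * (L : ℝ) ^ 4) := (bRate_antitone hK₃0 hK₄0 hb1 hhb).trans hrate
  have hEle : 2 * (K₃ / Real.sqrt b + K₄ / b + b ^ (-(1 / 4 : ℝ))) +
      (K₃ / Real.sqrt ((1 + 1 / (40 * (L : ℝ) ^ 4)) * b) + K₄ / ((1 + 1 / (40 * (L : ℝ) ^ 4)) * b) +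
        ((1 + 1 / (40 * (L : ℝ) ^ 4)) * b) ^ (-(1 / 4 : ℝ))) ≤ 3 / (20000 * (L : ℝ) ^ 4) := by
    have e3 : (3 : ℝ) / (20000 * (L : ℝ) ^ 4) = 3 * (1 / (20000 * (L : ℝ) ^ 4)) := by ring
    rw [e3]; linarith
  have hbudget := stiff_budget (L := L) hEle
  -- `α ≤ e`
  have hαe : alpha L / (1 + 1 / (40 * (L : ℝ) ^ 4)) ≤ e / (1 + 1 / (40 * (L : ℝ) ^ 4)) :=
    div_le_div_of_nonneg_right (alpha_le_finrank_gnoFibreB_div_two (L := L)) (by positivity)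
  have hZ0 : 0 ≤ ∫ p in Rg, Real.exp (-(b * F p)) ∂μB := hZpos.le
  have hκ : stiffKappa L (1 / 8) ≤ e / (1 + 1 / (40 * (L : ℝ) ^ 4)) -
      (2 * (K₃ / Real.sqrt b + K₄ / b + b ^ (-(1 / 4 : ℝ))) +
        (K₃ / Real.sqrt ((1 + 1 / (40 * (L : ℝ) ^ 4)) * b) + K₄ / ((1 + 1 / (40 * (L : ℝ) ^ 4)) * b) +
          ((1 + 1 / (40 * (L : ℝ) ^ 4)) * b) ^ (-(1 / 4 : ℝ)))) / (1 / (40 * (L : ℝ) ^ 4)) := by linarith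
  exact le_trans (mul_le_mul_of_nonneg_right hκ hZ0) hst

end Summit.QuantumFields.YangMills.Theorems.SwapVirialDeficit.BlowUpRing

end
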